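import Mathlib.Algebra.MonoidAlgebra.Basic
import Mathlib.Tactic.Group
import Literature.Combinatorics.Additive.TripleProductProperty
import HarnessLib

/-!
# The triple product property in the group algebra: counting solutions

Topic `Literature/Combinatorics/Additive`. For finite subsets `S, T, U` of a group `G` write
`𝟙_A = ∑_{a ∈ A} a` and `𝟙_{A⁻¹} = ∑_{a ∈ A} a⁻¹` in the group algebra `k[G]` (`indicatorElem`,
`indicatorElemInv`).
The coefficient at `1` of a product of such elements counts solutions of the corresponding word
equation (`coeff_one_sum_single`, `sum_single_mul_sum_single`), and the triple product property
(the tree's `TripleProductProperty`, Cohn–Umans 2003, Def. 2.1) evaluates two of these counts: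

* `TripleProductProperty.coeff_one_six` —
  `(𝟙_{S⁻¹} 𝟙_T · 𝟙_{T⁻¹} 𝟙_U · 𝟙_{U⁻¹} 𝟙_S)(1) = |S||T||U|` ("the value at the identity in the
  6-fold convolution `1_S * 1_{S⁻¹} * 1_T * 1_{T⁻¹} * 1_U * 1_{U⁻¹}` equals `|S||T||U|`",
  Blasiak–Cohn–Grochow–Pratt–Umans 2023, proof of Thm. 3.2, in the cyclically rotated form used
  there after "Thus");
* `TripleProductProperty.coeff_one_four` — `(𝟙_{T⁻¹} 𝟙_S · 𝟙_{S⁻¹} 𝟙_T)(1) = |S||T|` when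
  `U ≠ ∅` (the map `(s,t) ↦ s⁻¹t` is injective on `S × T`: "`1_{S⁻¹} * 1_T` … is equal to the
  indicator function of `S⁻¹T` by the triple product property", loc. cit.), which is the
  `ℓ²`-norm `∑_g |(1_{S⁻¹} * 1_T)(g)|²` entering Parseval;
* `TripleProductProperty.rotate` — the property is invariant under cyclic rotation of `(S,T,U)`.

These are the combinatorial inputs of
`Literature/Barriers/MatrixMultiplication/QuasirandomBarrierProofs.lean`.

## References

* H. Cohn, C. Umans, *A group-theoretic approach to fast matrix multiplication*, FOCS 2003,
  Def. 2.1 and §2 (TPP ⇔ the group algebra product restricts to matrix multiplication).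
  [CohnUmans2003]
* J. Blasiak, H. Cohn, J. A. Grochow, K. Pratt, C. Umans, *Matrix multiplication via matrix
  groups*, ITCS 2023, arXiv:2204.03826, proof of Thm. 3.2. [BlasiakCohnGrochowPrattUmans2023]
-/

noncomputable section

open scoped BigOperators

namespace Literature.Combinatorics.Additive

variable {G : Type*} (k : Type*) [Semiring k]

/-- `𝟙_A = ∑_{a ∈ A} a ∈ k[G]`, the indicator function of `A` as an element of the group algebra.
[cite: BlasiakCohnGrochowPrattUmans2023, Thm. 3.2 (proof)] -/
def indicatorElem (A : Finset G) : MonoidAlgebra k G := ∑ a ∈ A, MonoidAlgebra.single a 1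

/-- `𝟙_{A⁻¹} = ∑_{a ∈ A} a⁻¹ ∈ k[G]`, the indicator function of `A⁻¹ = {a⁻¹ : a ∈ A}`.
[cite: BlasiakCohnGrochowPrattUmans2023, Thm. 3.2 (proof)] -/
def indicatorElemInv [Inv G] (A : Finset G) : MonoidAlgebra k G :=
  ∑ a ∈ A, MonoidAlgebra.single a⁻¹ 1

variable {k}

/-- Unfolding `indicatorElem`. [folklore] -/
theorem indicatorElem_def (A : Finset G) :
    indicatorElem k A = ∑ a ∈ A, MonoidAlgebra.single a (1 : k) := rfl

/-- Unfolding `indicatorElemInv`. [folklore] -/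
theorem indicatorElemInv_def [Inv G] (A : Finset G) :
    indicatorElemInv k A = ∑ a ∈ A, MonoidAlgebra.single a⁻¹ (1 : k) := rfl

/-- Products of sums of group elements: `(∑_{a∈A} f(a)) (∑_{b∈B} g(b)) = ∑_{(a,b)} f(a)g(b)` in
`k[G]`. [folklore] -/
theorem sum_single_mul_sum_single [Mul G] {α β : Type*} (A : Finset α) (B : Finset β) (f : α → G)
    (g : β → G) :
    (∑ a ∈ A, MonoidAlgebra.single (f a) (1 : k)) * (∑ b ∈ B, MonoidAlgebra.single (g b) (1 : k)) =
      ∑ p ∈ A ×ˢ B, MonoidAlgebra.single (f p.1 * g p.2) (1 : k) := by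
  rw [Finset.sum_product, Finset.sum_mul_sum]
  simp only [MonoidAlgebra.single_mul_single, mul_one]

/-- The coefficient at `1` of `∑_{a ∈ A} f(a) ∈ k[G]` is the number of `a ∈ A` with `f(a) = 1`.
[folklore] -/
theorem coeff_one_sum_single [One G] {α : Type*} [DecidableEq G] (A : Finset α) (f : α → G) :
    (∑ a ∈ A, MonoidAlgebra.single (f a) (1 : k)).coeff 1 =
      ((A.filter fun a => f a = 1).card : k) := by
  simp only [MonoidAlgebra.coeff_sum, MonoidAlgebra.coeff_single, Finset.sum_apply',
    Finsupp.single_apply, Finset.sum_boole]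

/-- The triple product property is invariant under cyclic rotation of the three sets
(`q₂ q₃ q₁ = 1 ⇔ q₁ q₂ q₃ = 1` by conjugation). [cite: CohnUmans2003, Def. 2.1] -/
theorem TripleProductProperty.rotate [Group G] {S T U : Finset G}
    (h : TripleProductProperty S T U) : TripleProductProperty T U S := by
  intro t ht t' ht' u hu u' hu' s hs s' hs' heq
  have heq' : s * s'⁻¹ * (t * t'⁻¹) * (u * u'⁻¹) = 1 :=
    calc s * s'⁻¹ * (t * t'⁻¹) * (u * u'⁻¹)
        = s * s'⁻¹ * (t * t'⁻¹ * (u * u'⁻¹) * (s * s'⁻¹)) * (s * s'⁻¹)⁻¹ := by group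
      _ = 1 := by rw [heq]; group
  obtain ⟨hs1, ht1, hu1⟩ := h s hs s' hs' t ht t' ht' u hu u' hu' heq'
  exact ⟨ht1, hu1, hs1⟩

section Count

variable [Group G] [DecidableEq G] {S T U : Finset G}

/-- Under the triple product property the solutions of `s⁻¹ t · t'⁻¹ u · u'⁻¹ s' = 1` with
`s, s' ∈ S`, `t, t' ∈ T`, `u, u' ∈ U` are exactly the diagonal ones `s = s'`, `t = t'`, `u = u'`
(a cyclic rotation of Def. 2.1). [cite: BlasiakCohnGrochowPrattUmans2023, Thm. 3.2 (proof)] -/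
theorem TripleProductProperty.filter_six_eq_image (h : TripleProductProperty S T U) :
    ((((S ×ˢ T) ×ˢ (T ×ˢ U)) ×ˢ (U ×ˢ S)).filter fun y : ((G × G) × (G × G)) × (G × G) =>
        y.1.1.1⁻¹ * y.1.1.2 * (y.1.2.1⁻¹ * y.1.2.2) * (y.2.1⁻¹ * y.2.2) = 1) =
      (S ×ˢ T ×ˢ U).image fun x : G × G × G => (((x.1, x.2.1), (x.2.1, x.2.2)), (x.2.2, x.1)) := by
  ext ⟨⟨⟨s, t⟩, ⟨t', u⟩⟩, ⟨u', s'⟩⟩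
  simp only [Finset.mem_filter, Finset.mem_product, Finset.mem_image, Prod.mk.injEq, Prod.exists]
  constructor
  · rintro ⟨⟨⟨⟨hs, ht⟩, ht', hu⟩, hu', hs'⟩, heq⟩
    have heq' : s' * s⁻¹ * (t * t'⁻¹) * (u * u'⁻¹) = 1 :=
      calc s' * s⁻¹ * (t * t'⁻¹) * (u * u'⁻¹)
          = s' * (s⁻¹ * t * (t'⁻¹ * u) * (u'⁻¹ * s')) * s'⁻¹ := by group
        _ = 1 := by rw [heq]; group
    obtain ⟨rfl, rfl, rfl⟩ := h s' hs' s hs t ht t' ht' u hu u' hu' heq'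
    exact ⟨s', t, u, ⟨hs, ht, hu⟩, ⟨⟨rfl, rfl⟩, rfl, rfl⟩, rfl, rfl⟩
  · rintro ⟨a, b, c, ⟨ha, hb, hc⟩, ⟨⟨rfl, rfl⟩, rfl, rfl⟩, rfl, rfl⟩
    exact ⟨⟨⟨⟨ha, hb⟩, hb, hc⟩, hc, ha⟩, by group⟩

/-- **TPP ⇒ the 6-fold convolution at the identity is `|S||T||U|`**: in `k[G]`,
`(𝟙_{S⁻¹}𝟙_T · 𝟙_{T⁻¹}𝟙_U · 𝟙_{U⁻¹}𝟙_S)(1) = |S| |T| |U|` ("Equivalently, the value at the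
identity in the 6-fold convolution … equals `|S||T||U|`", BCGPU 2023, proof of Thm. 3.2, in its
cyclically rotated form `π(S⁻¹)π(T)π(T⁻¹)π(U)π(U⁻¹)π(S)`).
[cite: BlasiakCohnGrochowPrattUmans2023, Thm. 3.2 (proof)] -/
theorem TripleProductProperty.coeff_one_six (h : TripleProductProperty S T U) :
    ((indicatorElemInv k S * indicatorElem k T) * (indicatorElemInv k T * indicatorElem k U) *
        (indicatorElemInv k U * indicatorElem k S)).coeff 1 =
      ((S.card * T.card * U.card : ℕ) : k) := by
  rw [indicatorElemInv_def, indicatorElem_def, indicatorElemInv_def, indicatorElem_def,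
    indicatorElemInv_def, indicatorElem_def, sum_single_mul_sum_single,
    sum_single_mul_sum_single, sum_single_mul_sum_single, sum_single_mul_sum_single,
    sum_single_mul_sum_single, coeff_one_sum_single,
    h.filter_six_eq_image, Finset.card_image_of_injective, Finset.card_product,
    Finset.card_product, mul_assoc]
  rintro ⟨a, b, c⟩ ⟨a', b', c'⟩ hxy
  simp only [Prod.mk.injEq] at hxy
  obtain ⟨⟨⟨rfl, rfl⟩, -, rfl⟩, -⟩ := hxy
  rfl

/-- Under the triple product property (and `U ≠ ∅`) the solutions of `t⁻¹ s · s'⁻¹ t' = 1` with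
`s, s' ∈ S`, `t, t' ∈ T` are the diagonal ones (injectivity of `(s,t) ↦ s⁻¹ t` on `S × T`).
[cite: BlasiakCohnGrochowPrattUmans2023, Thm. 3.2 (proof)] -/
theorem TripleProductProperty.filter_four_eq_image (h : TripleProductProperty S T U)
    (hU : U.Nonempty) :
    (((T ×ˢ S) ×ˢ (S ×ˢ T)).filter fun y : (G × G) × (G × G) =>
        y.1.1⁻¹ * y.1.2 * (y.2.1⁻¹ * y.2.2) = 1) =
      (S ×ˢ T).image fun x : G × G => ((x.2, x.1), (x.1, x.2)) := by
  obtain ⟨u₀, hu₀⟩ := hU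
  ext ⟨⟨t, s⟩, ⟨s', t'⟩⟩
  simp only [Finset.mem_filter, Finset.mem_product, Finset.mem_image, Prod.mk.injEq, Prod.exists]
  constructor
  · rintro ⟨⟨⟨ht, hs⟩, hs', ht'⟩, heq⟩
    have heq' : s * s'⁻¹ * (t' * t⁻¹) * (u₀ * u₀⁻¹) = 1 :=
      calc s * s'⁻¹ * (t' * t⁻¹) * (u₀ * u₀⁻¹)
          = t * (t⁻¹ * s * (s'⁻¹ * t')) * t⁻¹ := by group
        _ = 1 := by rw [heq]; group
    obtain ⟨rfl, rfl, -⟩ := h s hs s' hs' t' ht' t ht u₀ hu₀ u₀ hu₀ heq'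
    exact ⟨s, t', ⟨hs, ht⟩, ⟨rfl, rfl⟩, rfl, rfl⟩
  · rintro ⟨a, b, ⟨ha, hb⟩, ⟨rfl, rfl⟩, rfl, rfl⟩
    exact ⟨⟨⟨hb, ha⟩, ha, hb⟩, by group⟩

/-- **TPP ⇒ `(𝟙_{T⁻¹}𝟙_S · 𝟙_{S⁻¹}𝟙_T)(1) = |S| |T|`** (for `U ≠ ∅`): the `ℓ²`-norm of
`1_{S⁻¹} * 1_T`, which "is equal to the indicator function of `S⁻¹T` by the triple product
property" (BCGPU 2023, proof of Thm. 3.2 — the input of Parseval's identity there).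
[cite: BlasiakCohnGrochowPrattUmans2023, Thm. 3.2 (proof)] -/
theorem TripleProductProperty.coeff_one_four (h : TripleProductProperty S T U) (hU : U.Nonempty) :
    ((indicatorElemInv k T * indicatorElem k S) *
        (indicatorElemInv k S * indicatorElem k T)).coeff 1 = ((S.card * T.card : ℕ) : k) := by
  rw [indicatorElemInv_def, indicatorElem_def, indicatorElemInv_def, indicatorElem_def,
    sum_single_mul_sum_single,
    sum_single_mul_sum_single, sum_single_mul_sum_single, coeff_one_sum_single,
    h.filter_four_eq_image hU, Finset.card_image_of_injective, Finset.card_product]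
  rintro ⟨a, b⟩ ⟨a', b'⟩ hxy
  simp only [Prod.mk.injEq] at hxy
  obtain ⟨⟨rfl, rfl⟩, -⟩ := hxy
  rfl

end Count

end Literature.Combinatorics.Additive

end
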